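import Summits.NavierStokesRegularity.NavierStokesRegularity.Theorems.EulerZoomLiouvillePowerGaugeEulerLiouvilleNeedleSlices
import Summits.NavierStokesRegularity.NavierStokesRegularity.Theorems.EulerZoomLiouvillePowerGaugeEulerLiouvilleNeedleSphereChart

/-!
# Sphere slicing through fixed cone charts (plate S2 of ROUND-36 «the needle's price, sphere by sphere»)

Measure-theoretic glue for the sphere-by-sphere needle portrait, with NO surface measure and NO change of
variables beyond dimension one:

* `lintegral_comp_capHeight_le` — the 1-D substitution `s = capHeight t z = √(t² − ‖z‖²)` (derivative
  `t/s ≥ 1`, injective) : `∫_{t ∈ R} G(capHeight t z) ≤ ∫ G`  (`lintegral_image_eq_lintegral_abs_deriv_mul`);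
* `lintegral_cone_le` — CONE TONELLI: for measurable `g ≥ 0`,
  `∫_{t ∈ I} ∫_{‖z‖ < θt} g (sphereChart e e₁ e₂ t z) dz dt ≤ ∫_S g` whenever the chart points lie in `S`
  (frame coordinates are measure preserving, t36d `measurePreserving_frameCoords`; then the 1-D substitution);
* `exists_good_radius` — Chebyshev in the radius inside a prescribed set `T` of radii of measure `≥ (b−a)/6`;
* `exists_cone_radii` — SIX-CONE PIGEONHOLE: if every sphere `S_t`, `t ∈ (L, 2L)`, meets a closed set `F`, then for
  one of the six signed frame directions `e` the radii `t` whose sphere meets `F` inside the cone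
  `{⟪y,e⟫ ≥ 0, ⟪y,e⟫² ≥ ‖y‖²/3}` form a measurable set of measure `≥ L/6`.

No Euler content. [folklore: Tonelli, one-dimensional change of variables, Chebyshev, pigeonhole]
-/

set_option linter.dupNamespace false

open MeasureTheory Set Metric Real
open scoped RealInnerProductSpace ENNReal

namespace Summit.NavierStokesRegularity.NavierStokesRegularity.Theorems.PowerGaugeEulerLiouville.NeedleSphereThinness

open NeedleDiscChart NeedleSphereChart NeedleThinness

/-! ## 1. The one-dimensional substitution `s = √(t² − ‖z‖²)` -/

/-- `t ↦ capHeight t z` has derivative `t / capHeight t z` where `‖z‖ < t`. [folklore: chain rule] -/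
theorem hasDerivAt_capHeight_radius {t : ℝ} {z : ℂ} (hzt : ‖z‖ < t) :
    HasDerivAt (fun t : ℝ => capHeight t z) (t / capHeight t z) t := by
  have hpos : 0 < t ^ 2 - ‖z‖ ^ 2 := by nlinarith [norm_nonneg z]
  have h1 : HasDerivAt (fun t : ℝ => t ^ 2 - ‖z‖ ^ 2) (2 * t) t := by
    simpa using (hasDerivAt_pow 2 t).sub_const (‖z‖ ^ 2)
  have h2 := h1.sqrt hpos.ne'
  have hs : Real.sqrt (t ^ 2 - ‖z‖ ^ 2) ≠ 0 := (Real.sqrt_pos.2 hpos).ne'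
  have heq : 2 * t / (2 * Real.sqrt (t ^ 2 - ‖z‖ ^ 2)) = t / capHeight t z := by
    rw [capHeight]; field_simp
  rw [← heq]
  exact h2

/-- `t ↦ capHeight t z` is injective on radii `t > ‖z‖`. [folklore] -/
theorem injOn_capHeight_radius (z : ℂ) {R : Set ℝ} (hRz : ∀ t ∈ R, ‖z‖ < t) :
    InjOn (fun t : ℝ => capHeight t z) R := by
  intro t ht t' ht' hff
  have hzt := hRz t ht
  have hzt' := hRz t' ht'
  have ht0 : 0 < t := lt_of_le_of_lt (norm_nonneg z) hzt
  have ht0' : 0 < t' := lt_of_le_of_lt (norm_nonneg z) hzt'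
  have h2 : capHeight t z ^ 2 = capHeight t' z ^ 2 := by
    simp only at hff
    rw [hff]
  rw [capHeight_sq hzt.le, capHeight_sq hzt'.le] at h2
  have h3 : t ^ 2 = t' ^ 2 := by linarith
  exact (pow_left_inj₀ ht0.le ht0'.le two_ne_zero).mp h3

/-- **1-D substitution.**  For measurable `G ≥ 0` and a measurable set of radii `R` with `‖z‖ < t` on `R`:
`∫_{t ∈ R} G (capHeight t z) dt ≤ ∫ G ds` — the substitution `s = √(t² − ‖z‖²)` has Jacobian `t/s ≥ 1`.
[folklore: one-dimensional change of variables] -/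
theorem lintegral_comp_capHeight_le (G : ℝ → ℝ≥0∞) (z : ℂ) {R : Set ℝ}
    (hR : MeasurableSet R) (hRz : ∀ t ∈ R, ‖z‖ < t) :
    ∫⁻ t in R, G (capHeight t z) ≤ ∫⁻ s, G s := by
  have hderiv : ∀ t ∈ R, HasDerivWithinAt (fun t : ℝ => capHeight t z) (t / capHeight t z) R t :=
    fun t ht => (hasDerivAt_capHeight_radius (hRz t ht)).hasDerivWithinAt
  have hinj := injOn_capHeight_radius z hRz
  have hge : ∀ t ∈ R, G (capHeight t z) ≤ ENNReal.ofReal |t / capHeight t z| * G (capHeight t z) := by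
    intro t ht
    have hzt := hRz t ht
    have ht0 : 0 < t := lt_of_le_of_lt (norm_nonneg z) hzt
    have hs := capHeight_pos hzt
    have hle := capHeight_le ht0.le z
    have h1 : (1 : ℝ) ≤ t / capHeight t z := by
      rw [le_div_iff₀ hs, one_mul]; exact hle
    have h2 : (1 : ℝ≥0∞) ≤ ENNReal.ofReal |t / capHeight t z| := by
      rw [abs_of_pos (div_pos ht0 hs)]
      exact ENNReal.one_le_ofReal.2 h1
    calc G (capHeight t z) = 1 * G (capHeight t z) := (one_mul _).symm
      _ ≤ ENNReal.ofReal |t / capHeight t z| * G (capHeight t z) := mul_le_mul_of_nonneg_right h2 bot_le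
  calc ∫⁻ t in R, G (capHeight t z) ≤ ∫⁻ t in R, ENNReal.ofReal |t / capHeight t z| * G (capHeight t z) :=
        setLIntegral_mono' hR hge
    _ = ∫⁻ s in (fun t : ℝ => capHeight t z) '' R, G s :=
        (lintegral_image_eq_lintegral_abs_deriv_mul hR hderiv hinj G).symm
    _ ≤ ∫⁻ s, G s := setLIntegral_le_lintegral _ _

/-! ## 2. Cone Tonelli -/

/-- Joint continuity of `(t, z) ↦ capHeight t z`. [folklore] -/
theorem continuous_capHeight₂ : Continuous fun p : ℝ × ℂ => capHeight p.1 p.2 :=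
  Real.continuous_sqrt.comp ((continuous_fst.pow 2).sub (continuous_snd.norm.pow 2))

/-- Joint continuity of the cone parametrisation `(t, z) ↦ sphereChart e e₁ e₂ t z`. [folklore] -/
theorem continuous_sphereChart₂ (e e₁ e₂ : (EuclideanSpace ℝ (Fin 3))) :
    Continuous fun p : ℝ × ℂ => sphereChart e e₁ e₂ p.1 p.2 := by
  have h : (fun p : ℝ × ℂ => sphereChart e e₁ e₂ p.1 p.2) =
      fun p => capHeight p.1 p.2 • e + discChartL e₁ e₂ p.2 := by
    funext p; rw [sphereChart_eq]
  rw [h]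
  exact (continuous_capHeight₂.smul continuous_const).add ((discChartL e₁ e₂).continuous.comp continuous_snd)

section Cone

variable {e e₁ e₂ : (EuclideanSpace ℝ (Fin 3))}

/-- **Cone Tonelli.**  For measurable `g ≥ 0`, a measurable set of positive radii `I`, an aperture
`0 < θ ≤ 1`, and a measurable set `S` containing every chart point `sphereChart e e₁ e₂ t z`, `t ∈ I`, `‖z‖ < θt`:
`∫_{t ∈ I} ∫_{‖z‖ < θ t} g (sphereChart e e₁ e₂ t z) dz dt ≤ ∫_S g`.
(Frame coordinates preserve Lebesgue measure; in them the cone map is `(t, z) ↦ (√(t²−‖z‖²), z)`, triangular with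
`∂s/∂t = t/s ≥ 1`, so only the 1-D substitution of §1 is needed.) [folklore: Tonelli + 1-D change of variables] -/
theorem lintegral_cone_le (hon : Orthonormal ℝ ![e, e₁, e₂]) {g : (EuclideanSpace ℝ (Fin 3)) → ℝ≥0∞}
    (hg : Measurable g) {I : Set ℝ} (hI : MeasurableSet I) (hIpos : ∀ t ∈ I, 0 < t) {θ : ℝ} (hθ1 : θ ≤ 1)
    {S : Set (EuclideanSpace ℝ (Fin 3))} (hS : MeasurableSet S)
    (hmaps : ∀ t ∈ I, ∀ z : ℂ, ‖z‖ < θ * t → sphereChart e e₁ e₂ t z ∈ S) :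
    ∫⁻ t in I, ∫⁻ z in ball (0 : ℂ) (θ * t), g (sphereChart e e₁ e₂ t z) ≤ ∫⁻ y in S, g y := by
  set b : OrthonormalBasis (Fin 3) ℝ (EuclideanSpace ℝ (Fin 3)) := OrthonormalBasis.mk hon (top_le_span_frame hon)
    with hbdef
  have hb : ⇑b = ![e, e₁, e₂] := OrthonormalBasis.coe_mk _ _
  have hb0 : b 0 = e := by rw [hb]; rfl
  have hb1 : b 1 = e₁ := by rw [hb]; rfl
  have hb2 : b 2 = e₂ := by rw [hb]; rfl
  set Ψ : ℝ × ℂ → (EuclideanSpace ℝ (Fin 3)) := ⇑b.repr.symm ∘ WithLp.toLp 2 ∘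
    ⇑(MeasurableEquiv.piFinSuccAbove (fun _ : Fin 3 => ℝ) 0).symm ∘ Prod.map id ⇑Complex.measurableEquivPi with hΨdef
  have hΨ : MeasurePreserving Ψ := measurePreserving_frameCoords b
  have hΨapply : ∀ (s : ℝ) (z : ℂ), Ψ (s, z) = discChart (s • e) e₁ e₂ z := by
    intro s z
    rw [hΨdef, frameCoords_apply, hb0, hb1, hb2]
  have hchart : ∀ (t : ℝ) (z : ℂ), sphereChart e e₁ e₂ t z = Ψ (capHeight t z, z) := by
    intro t z
    rw [hΨapply, sphereChart]
  -- the pulled-back integrand on frame coordinates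
  set G : ℝ × ℂ → ℝ≥0∞ := fun p => S.indicator g (Ψ p) with hGdef
  have hGm : Measurable G := (hg.indicator hS).comp hΨ.measurable
  -- the cone region in the (t, z) variables and the integrand there
  set K : Set (ℝ × ℂ) := {p | p.1 ∈ I ∧ ‖p.2‖ < θ * p.1} with hKdef
  have hKm : MeasurableSet K :=
    (measurable_fst hI).inter (measurableSet_lt continuous_snd.norm.measurable (measurable_fst.const_mul θ))
  set H : ℝ × ℂ → ℝ≥0∞ := K.indicator fun p => G (capHeight p.1 p.2, p.2) with hHdef
  have hinner : Measurable fun p : ℝ × ℂ => G (capHeight p.1 p.2, p.2) :=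
    hGm.comp (continuous_capHeight₂.prodMk continuous_snd).measurable
  have hHm : Measurable H := hinner.indicator hKm
  -- Step 1: the iterated integral is dominated by ∫∫ H
  have step1 : ∫⁻ t in I, ∫⁻ z in ball (0 : ℂ) (θ * t), g (sphereChart e e₁ e₂ t z) ≤ ∫⁻ t, ∫⁻ z, H (t, z) := by
    calc ∫⁻ t in I, ∫⁻ z in ball (0 : ℂ) (θ * t), g (sphereChart e e₁ e₂ t z)
        = ∫⁻ t in I, ∫⁻ z in ball (0 : ℂ) (θ * t), H (t, z) := by
          refine setLIntegral_congr_fun hI fun t ht => ?_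
          refine setLIntegral_congr_fun measurableSet_ball fun z hz => ?_
          have hz' : ‖z‖ < θ * t := mem_ball_zero_iff.mp hz
          have hK : (t, z) ∈ K := ⟨ht, hz'⟩
          rw [hHdef, indicator_of_mem hK, hGdef]
          simp only
          rw [← hchart, indicator_of_mem (hmaps t ht z hz')]
      _ ≤ ∫⁻ t in I, ∫⁻ z, H (t, z) := setLIntegral_mono' hI fun t _ => setLIntegral_le_lintegral _ _
      _ ≤ ∫⁻ t, ∫⁻ z, H (t, z) := setLIntegral_le_lintegral _ _
  -- Step 2: swap, and bound each z-fibre by the 1-D substitution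
  have step2 : ∫⁻ t, ∫⁻ z, H (t, z) = ∫⁻ z, ∫⁻ t, H (t, z) :=
    lintegral_lintegral_swap (hHm.comp measurable_id).aemeasurable
  have step3 : ∀ z : ℂ, ∫⁻ t, H (t, z) ≤ ∫⁻ s, G (s, z) := by
    intro z
    set R : Set ℝ := {t | t ∈ I ∧ ‖z‖ < θ * t} with hRdef
    have hRm : MeasurableSet R := hI.inter (measurableSet_lt measurable_const (measurable_id.const_mul θ))
    have hHR : ∀ t, H (t, z) = R.indicator (fun t => G (capHeight t z, z)) t := by
      intro t
      by_cases h : t ∈ I ∧ ‖z‖ < θ * t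
      · have hK : (t, z) ∈ K := h
        rw [hHdef, indicator_of_mem hK, indicator_of_mem (show t ∈ R from h)]
      · have hK : (t, z) ∉ K := h
        rw [hHdef, indicator_of_notMem hK, indicator_of_notMem (show t ∉ R from h)]
    have hRz : ∀ t ∈ R, ‖z‖ < t := by
      intro t ht
      have ht0 := hIpos t ht.1
      calc ‖z‖ < θ * t := ht.2
        _ ≤ 1 * t := mul_le_mul_of_nonneg_right hθ1 ht0.le
        _ = t := one_mul t
    calc ∫⁻ t, H (t, z) = ∫⁻ t, R.indicator (fun t => G (capHeight t z, z)) t := lintegral_congr hHR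
      _ = ∫⁻ t in R, G (capHeight t z, z) := lintegral_indicator hRm _
      _ ≤ ∫⁻ s, G (s, z) :=
          lintegral_comp_capHeight_le (fun s => G (s, z)) z hRm hRz
  -- Step 3: reassemble ∫_z ∫_s G = ∫ G = ∫_S g
  have step4 : ∫⁻ z, ∫⁻ s, G (s, z) = ∫⁻ y in S, g y := by
    have hsw : AEMeasurable (Function.uncurry fun (z : ℂ) (s : ℝ) => G (s, z)) (volume.prod volume) :=
      (hGm.comp measurable_swap).aemeasurable
    calc ∫⁻ z, ∫⁻ s, G (s, z) = ∫⁻ s, ∫⁻ z, G (s, z) := lintegral_lintegral_swap hsw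
      _ = ∫⁻ p : ℝ × ℂ, G p := by
          rw [Measure.volume_eq_prod]
          exact (lintegral_prod _ hGm.aemeasurable).symm
      _ = ∫⁻ y, S.indicator g y := hΨ.lintegral_comp (hg.indicator hS)
      _ = ∫⁻ y in S, g y := lintegral_indicator hS _
  calc ∫⁻ t in I, ∫⁻ z in ball (0 : ℂ) (θ * t), g (sphereChart e e₁ e₂ t z) ≤ ∫⁻ t, ∫⁻ z, H (t, z) := step1
    _ = ∫⁻ z, ∫⁻ t, H (t, z) := step2
    _ ≤ ∫⁻ z, ∫⁻ s, G (s, z) := lintegral_mono step3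
    _ = ∫⁻ y in S, g y := step4

end Cone

/-! ## 3. A good radius inside a prescribed set of radii (Chebyshev) -/

/-- **Good radius.**  If `∫_{(a,b)} F ≤ X`, `∫_{(a,b)} G ≤ Y` and `T ⊆ (a, b)` is measurable with `|T| ≥ (b−a)/6`,
some `t ∈ T` has `F t < 16X/(b−a)` and `G t < 16Y/(b−a)` (each bad set has measure `≤ (b−a)/16`).
[folklore: Chebyshev] -/
theorem exists_good_radius {F G : ℝ → ℝ≥0∞} (hF : Measurable F) (hG : Measurable G) {a b X Y : ℝ}
    (hab : a < b) (hX : 0 < X) (hY : 0 < Y)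
    (hIF : ∫⁻ t in Ioo a b, F t ≤ ENNReal.ofReal X) (hIG : ∫⁻ t in Ioo a b, G t ≤ ENNReal.ofReal Y)
    {T : Set ℝ} (hT : MeasurableSet T) (hTI : T ⊆ Ioo a b) (hTvol : ENNReal.ofReal ((b - a) / 6) ≤ volume T) :
    ∃ t ∈ T, F t < ENNReal.ofReal (16 * X / (b - a)) ∧ G t < ENNReal.ofReal (16 * Y / (b - a)) := by
  set I : Set ℝ := Ioo a b with hI
  have hℓ : 0 < b - a := sub_pos.2 hab
  have cheb : ∀ {H : ℝ → ℝ≥0∞}, Measurable H → ∀ {Z : ℝ}, 0 < Z →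
      ∫⁻ t in I, H t ≤ ENNReal.ofReal Z →
      volume.restrict I {t | ENNReal.ofReal (16 * Z / (b - a)) ≤ H t} ≤ ENNReal.ofReal ((b - a) / 16) := by
    intro H hH Z hZ hIH
    have h := (mul_meas_ge_le_lintegral₀ (μ := volume.restrict I) hH.aemeasurable
      (ENNReal.ofReal (16 * Z / (b - a)))).trans hIH
    have hc : ENNReal.ofReal (16 * Z / (b - a)) ≠ 0 := (ENNReal.ofReal_pos.2 (by positivity)).ne'
    have hc' : ENNReal.ofReal (16 * Z / (b - a)) ≠ ∞ := ENNReal.ofReal_ne_top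
    calc volume.restrict I {t | ENNReal.ofReal (16 * Z / (b - a)) ≤ H t}
        ≤ ENNReal.ofReal Z / ENNReal.ofReal (16 * Z / (b - a)) := by
          rw [ENNReal.le_div_iff_mul_le (Or.inl hc) (Or.inl hc'), mul_comm]; exact h
      _ = ENNReal.ofReal ((b - a) / 16) := by
          rw [← ENNReal.ofReal_div_of_pos (by positivity)]
          congr 1
          field_simp
  have hbF := cheb hF hX hIF
  have hbG := cheb hG hY hIG
  set bad : Set ℝ := {t | ENNReal.ofReal (16 * X / (b - a)) ≤ F t} ∪ {t | ENNReal.ofReal (16 * Y / (b - a)) ≤ G t}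
    with hbad
  have hbadm : MeasurableSet bad :=
    (measurableSet_le measurable_const hF).union (measurableSet_le measurable_const hG)
  have hμbad : volume.restrict I bad ≤ ENNReal.ofReal ((b - a) / 8) := by
    calc volume.restrict I bad ≤ volume.restrict I {t | ENNReal.ofReal (16 * X / (b - a)) ≤ F t} +
          volume.restrict I {t | ENNReal.ofReal (16 * Y / (b - a)) ≤ G t} := measure_union_le _ _
      _ ≤ ENNReal.ofReal ((b - a) / 16) + ENNReal.ofReal ((b - a) / 16) := add_le_add hbF hbG
      _ = ENNReal.ofReal ((b - a) / 8) := by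
          rw [← ENNReal.ofReal_add (by positivity) (by positivity)]
          congr 1
          ring
  -- `T` has restricted measure ≥ (b − a)/6 > (b − a)/8 ≥ measure of the bad set, so `T \ bad` is non-null
  have hTres : volume.restrict I T = volume T := by
    rw [Measure.restrict_apply hT, inter_eq_left.2 hTI]
  have hpos : volume.restrict I (T \ bad) ≠ 0 := by
    intro h0
    have h1 : volume.restrict I T ≤ volume.restrict I (T \ bad) + volume.restrict I bad := by
      calc volume.restrict I T ≤ volume.restrict I ((T \ bad) ∪ bad) :=
            measure_mono fun x hx => by
              by_cases h : x ∈ bad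
              · exact Or.inr h
              · exact Or.inl ⟨hx, h⟩
        _ ≤ volume.restrict I (T \ bad) + volume.restrict I bad := measure_union_le _ _
    rw [h0, zero_add, hTres] at h1
    have h2 : ENNReal.ofReal ((b - a) / 6) ≤ ENNReal.ofReal ((b - a) / 8) := (hTvol.trans h1).trans hμbad
    rw [ENNReal.ofReal_le_ofReal_iff (by positivity)] at h2
    linarith
  have hne : ((T \ bad) ∩ I).Nonempty := by
    apply nonempty_of_measure_ne_zero (μ := volume)
    rwa [Measure.restrict_apply (hT.diff hbadm)] at hpos
  obtain ⟨t, ⟨htT, htbad⟩, -⟩ := hne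
  refine ⟨t, htT, ?_, ?_⟩
  · exact not_le.1 fun h => htbad (Or.inl h)
  · exact not_le.1 fun h => htbad (Or.inr h)

/-! ## 4. Six-cone pigeonhole -/

section Pigeonhole

variable {u u₁ u₂ : (EuclideanSpace ℝ (Fin 3))}

/-- The radii in `(L, 2L)` at which a closed set `F` meets the closed cone of direction `v`:
`Ioo L (2L) ∩ ‖·‖ '' (F ∩ cone ∩ closedBall 0 (2L))`. -/
def coneRadii (F : Set (EuclideanSpace ℝ (Fin 3))) (v : (EuclideanSpace ℝ (Fin 3))) (L : ℝ) : Set ℝ :=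
  Ioo L (2 * L) ∩ ((fun y : (EuclideanSpace ℝ (Fin 3)) => ‖y‖) ''
    (F ∩ {y | ‖y‖ ^ 2 / 3 ≤ ⟪y, v⟫ ^ 2 ∧ 0 ≤ ⟪y, v⟫} ∩ closedBall 0 (2 * L)))

/-- The cone-radii set is measurable (a compact image intersected with an interval). [folklore] -/
theorem measurableSet_coneRadii {F : Set (EuclideanSpace ℝ (Fin 3))} (hF : IsClosed F) (v : (EuclideanSpace ℝ (Fin 3))) (L : ℝ) :
    MeasurableSet (coneRadii F v L) := by
  have hcone : IsClosed {y : (EuclideanSpace ℝ (Fin 3)) | ‖y‖ ^ 2 / 3 ≤ ⟪y, v⟫ ^ 2 ∧ 0 ≤ ⟪y, v⟫} := by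
    have h1 : IsClosed {y : (EuclideanSpace ℝ (Fin 3)) | ‖y‖ ^ 2 / 3 ≤ ⟪y, v⟫ ^ 2} :=
      isClosed_le ((continuous_norm.pow 2).div_const 3) ((continuous_id.inner continuous_const).pow 2)
    have h2 : IsClosed {y : (EuclideanSpace ℝ (Fin 3)) | 0 ≤ ⟪y, v⟫} :=
      isClosed_le continuous_const (continuous_id.inner continuous_const)
    exact h1.inter h2
  have hK : IsCompact (F ∩ {y | ‖y‖ ^ 2 / 3 ≤ ⟪y, v⟫ ^ 2 ∧ 0 ≤ ⟪y, v⟫} ∩ closedBall (0 : (EuclideanSpace ℝ (Fin 3))) (2 * L)) :=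
    (isCompact_closedBall (0 : (EuclideanSpace ℝ (Fin 3))) (2 * L)).of_isClosed_subset ((hF.inter hcone).inter isClosed_closedBall)
      inter_subset_right
  exact measurableSet_Ioo.inter (hK.image continuous_norm).isClosed.measurableSet

/-- What membership in the cone-radii set provides. [definition unfolding] -/
theorem exists_of_mem_coneRadii {F : Set (EuclideanSpace ℝ (Fin 3))} {v : (EuclideanSpace ℝ (Fin 3))} {L t : ℝ} (ht : t ∈ coneRadii F v L) :
    t ∈ Ioo L (2 * L) ∧ ∃ y ∈ F, ‖y‖ = t ∧ ‖y‖ ^ 2 / 3 ≤ ⟪y, v⟫ ^ 2 ∧ 0 ≤ ⟪y, v⟫ := by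
  obtain ⟨htI, y, ⟨⟨hyF, hyc⟩, -⟩, hyt⟩ := ht
  exact ⟨htI, y, hyF, hyt, hyc.1, hyc.2⟩

/-- A point of `F` at radius `t ∈ (L, 2L)` in the (two-sided) cone of `v` puts `t` in the cone-radii set of `v`
or of `−v`. [folklore] -/
theorem mem_coneRadii_or {F : Set (EuclideanSpace ℝ (Fin 3))} {v y : (EuclideanSpace ℝ (Fin 3))} {L t : ℝ} (htI : t ∈ Ioo L (2 * L)) (hyF : y ∈ F)
    (hyt : ‖y‖ = t) (hyv : ‖y‖ ^ 2 / 3 ≤ ⟪y, v⟫ ^ 2) : t ∈ coneRadii F v L ∨ t ∈ coneRadii F (-v) L := by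
  have hyball : y ∈ closedBall (0 : (EuclideanSpace ℝ (Fin 3))) (2 * L) := by
    rw [mem_closedBall_zero_iff, hyt]; exact htI.2.le
  rcases le_total 0 ⟪y, v⟫ with hs | hs
  · exact Or.inl ⟨htI, y, ⟨⟨hyF, hyv, hs⟩, hyball⟩, hyt⟩
  · refine Or.inr ⟨htI, y, ⟨⟨hyF, ?_, ?_⟩, hyball⟩, hyt⟩
    · rw [inner_neg_right, neg_sq]; exact hyv
    · rw [inner_neg_right]; linarith

/-- **Six-cone pigeonhole.**  If every sphere `S_t`, `t ∈ (L, 2L)`, meets the closed set `F`, then for one of the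
six signed directions of the frame the cone-radii set has measure `≥ L/6`; the output is that direction `e`,
completed to an orthonormal frame, with its radii set. [folklore: pigeonhole] -/
theorem exists_cone_radii (hon : Orthonormal ℝ ![u, u₁, u₂]) {F : Set (EuclideanSpace ℝ (Fin 3))} (hF : IsClosed F) {L : ℝ}
    (hL : 0 < L) (hfast : ∀ t ∈ Ioo L (2 * L), ∃ y ∈ F, ‖y‖ = t) :
    ∃ e e₁ e₂ : (EuclideanSpace ℝ (Fin 3)), Orthonormal ℝ ![e, e₁, e₂] ∧ MeasurableSet (coneRadii F e L) ∧
      coneRadii F e L ⊆ Ioo L (2 * L) ∧ ENNReal.ofReal (L / 6) ≤ volume (coneRadii F e L) := by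
  have hu : ‖u‖ = 1 := norm_frame₀ hon
  have h1 : ‖u₁‖ = 1 := norm_frame₁ hon
  have h2 : ‖u₂‖ = 1 := norm_frame₂ hon
  have h01 : ⟪u, u₁⟫ = 0 := inner_frame₀₁ hon
  have h02 : ⟪u, u₂⟫ = 0 := inner_frame₀₂ hon
  have h12 : ⟪u₁, u₂⟫ = 0 := inner_frame₁₂ hon
  have h10 : ⟪u₁, u⟫ = 0 := (real_inner_comm u u₁).trans h01
  have h20 : ⟪u₂, u⟫ = 0 := (real_inner_comm u u₂).trans h02
  have h21 : ⟪u₂, u₁⟫ = 0 := (real_inner_comm u₁ u₂).trans h12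
  -- the six frames
  have f1 : Orthonormal ℝ ![u, u₁, u₂] := hon
  have f2 : Orthonormal ℝ ![-u, u₁, u₂] :=
    orthonormal_frame (by rw [norm_neg, hu]) h1 h2 (by rw [inner_neg_left, h01, neg_zero])
      (by rw [inner_neg_left, h02, neg_zero]) h12
  have f3 : Orthonormal ℝ ![u₁, u, u₂] := orthonormal_frame h1 hu h2 h10 h12 h02
  have f4 : Orthonormal ℝ ![-u₁, u, u₂] :=
    orthonormal_frame (by rw [norm_neg, h1]) hu h2 (by rw [inner_neg_left, h10, neg_zero])
      (by rw [inner_neg_left, h12, neg_zero]) h02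
  have f5 : Orthonormal ℝ ![u₂, u, u₁] := orthonormal_frame h2 hu h1 h20 h21 h01
  have f6 : Orthonormal ℝ ![-u₂, u, u₁] :=
    orthonormal_frame (by rw [norm_neg, h2]) hu h1 (by rw [inner_neg_left, h20, neg_zero])
      (by rw [inner_neg_left, h21, neg_zero]) h01
  have hsub : ∀ v : (EuclideanSpace ℝ (Fin 3)), coneRadii F v L ⊆ Ioo L (2 * L) := fun v t ht => ht.1
  have hmeas : ∀ v : (EuclideanSpace ℝ (Fin 3)), MeasurableSet (coneRadii F v L) := fun v => measurableSet_coneRadii hF v L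
  -- cover
  have hcover : Ioo L (2 * L) ⊆ ((coneRadii F u L ∪ coneRadii F (-u) L) ∪ (coneRadii F u₁ L ∪ coneRadii F (-u₁) L)) ∪
      (coneRadii F u₂ L ∪ coneRadii F (-u₂) L) := by
    intro t ht
    obtain ⟨y, hyF, hyt⟩ := hfast t ht
    rcases exists_inner_sq_ge hon y with hy | hy | hy
    · exact Or.inl (Or.inl (mem_coneRadii_or ht hyF hyt hy))
    · exact Or.inl (Or.inr (mem_coneRadii_or ht hyF hyt hy))
    · exact Or.inr (mem_coneRadii_or ht hyF hyt hy)
  -- pigeonhole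
  by_contra hcon
  simp only [not_exists, not_and, not_le] at hcon
  have c1 := hcon u u₁ u₂ f1 (hmeas u) (hsub u)
  have c2 := hcon (-u) u₁ u₂ f2 (hmeas (-u)) (hsub (-u))
  have c3 := hcon u₁ u u₂ f3 (hmeas u₁) (hsub u₁)
  have c4 := hcon (-u₁) u u₂ f4 (hmeas (-u₁)) (hsub (-u₁))
  have c5 := hcon u₂ u u₁ f5 (hmeas u₂) (hsub u₂)
  have c6 := hcon (-u₂) u u₁ f6 (hmeas (-u₂)) (hsub (-u₂))
  have hvol : volume (Ioo L (2 * L)) = ENNReal.ofReal L := by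
    rw [Real.volume_Ioo]; congr 1; ring
  have hle : ENNReal.ofReal L ≤ ((volume (coneRadii F u L) + volume (coneRadii F (-u) L)) +
      (volume (coneRadii F u₁ L) + volume (coneRadii F (-u₁) L))) +
      (volume (coneRadii F u₂ L) + volume (coneRadii F (-u₂) L)) := by
    rw [← hvol]
    refine (measure_mono hcover).trans ?_
    refine (measure_union_le _ _).trans (add_le_add ((measure_union_le _ _).trans (add_le_add
      (measure_union_le _ _) (measure_union_le _ _))) (measure_union_le _ _))
  have hlt : ((volume (coneRadii F u L) + volume (coneRadii F (-u) L)) +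
      (volume (coneRadii F u₁ L) + volume (coneRadii F (-u₁) L))) +
      (volume (coneRadii F u₂ L) + volume (coneRadii F (-u₂) L)) <
      ((ENNReal.ofReal (L / 6) + ENNReal.ofReal (L / 6)) + (ENNReal.ofReal (L / 6) + ENNReal.ofReal (L / 6))) +
      (ENNReal.ofReal (L / 6) + ENNReal.ofReal (L / 6)) :=
    ENNReal.add_lt_add (ENNReal.add_lt_add (ENNReal.add_lt_add c1 c2) (ENNReal.add_lt_add c3 c4))
      (ENNReal.add_lt_add c5 c6)
  have hsum : ((ENNReal.ofReal (L / 6) + ENNReal.ofReal (L / 6)) + (ENNReal.ofReal (L / 6) + ENNReal.ofReal (L / 6))) +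
      (ENNReal.ofReal (L / 6) + ENNReal.ofReal (L / 6)) = ENNReal.ofReal L := by
    have h6 : (0 : ℝ) ≤ L / 6 := by positivity
    rw [← ENNReal.ofReal_add h6 h6, ← ENNReal.ofReal_add (by positivity) (by positivity),
      ← ENNReal.ofReal_add (by positivity) (by positivity)]
    congr 1; ring
  rw [hsum] at hlt
  exact absurd (hle.trans_lt hlt) (lt_irrefl _)

end Pigeonhole

end Summit.NavierStokesRegularity.NavierStokesRegularity.Theorems.PowerGaugeEulerLiouville.NeedleSphereThinness
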